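import Literature.NumberTheory.Automorphic.UnitaryGroupUnipotentTermCMConst
import Literature.NumberTheory.Automorphic.UnitaryGroupCentralSocketClosed
import HarnessLib

/-!
# The central socket of the trace formula for the quasi-split `U(J₃)` of a CM field, CLOSED with CONSTANTS FIRST:
# `∃ C₀ C₁ C₂, ∀ f, Σ_{i ∈ S, i central} p_i(0) = Σ_i (μ(X)·f(z_i) + c_μ·(Cc_{C₀}(z_i, f) + B_{C₁,C₂}(z_i, f)))`
(Rogawski, *Automorphic Representations of Unitary Groups in Three Variables* (1990), Prop. 7.3.2 (pp. 96–97): the unipotent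
term `J^T_G(𝒪_st, f)`, `𝒪 = 𝒪(γ)` with `γ` central, is the sum of the terms (a) `m(𝐙G∖𝐆) f(γ)`, (b) `D Φ^M(γ, f)`, (c), (d)
`½ m(𝐙S∖𝐒) ∫_{I_F} f^K(γ n(tδ₀)) χ(t) |t|² d^*t`, (e) `½ m(𝐙M∖𝐌¹) J^T_M(γ, f)` — the constants `m(·)`, `D` are Haar volumes, the SAME
for every central `γ` and every `f`; Arthur, *The trace formula in invariant form*, Ann. of Math. 114 (1981), Prop. 2.3: `J^T_𝔬(f)`
is a polynomial in `log T` and `J_𝔬(f)` its constant term.)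

Topic `NumberTheory/Automorphic`; namespace `Literature.NumberTheory.Automorphic.UnitaryGroup`. THEOREMS ONLY over accepted tree
modules (no definition, no named fact, no instance, no notation, no `sorry`). Item (σ-i)″ «FINSET CLOSER OF THE CENTRAL SOCKET,
CONSTANTS FIRST» of the T1-qs LAW 5 road of `Cruxes/H413/Lines/F0_T1InnerFormTraceIdentity.lean` (cell `pub/hodgecm-mathlib`, crux
H413). The finset closer ★ `exists_keyrep_sum_filter_central_classPolynomial_eval_zero_cm` (`UnitaryGroupCentralSocketClosed`) closes
the central socket of ★ `arthurTrace_eq_sum_orbital_add_sum_central_add_sum_singular_add_sum_hyperbolic_cm` with the Haar constants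
`(C₀, C₁, C₂)_i` of the per-class head ★ `truncatedTraceClass_central_eq_linear_cm` CHOSEN PER CLASS (they sit behind the class
data there). This file re-instantiates the same bookkeeping (★ KEYED GLUE `exists_rep_sum_classPolynomial_eval_zero_eq`,
`UnitaryGroupTruncatedTraceClassKeyedSocketGlue`, the variant whose constants are FUNCTIONS of the key) over the CONSTANTS-FIRST head
★ `exists_const_truncatedTraceClass_central_eq_linear_cm` (`UnitaryGroupUnipotentTermCMConst`, B-p17): the three constants
`C₀ > 0` (centre lattice), `C₁ > 0` (Iwasawa ∕ Weil), `C₂ ∈ (0, ∞)` (torus push) are quantified ONCE, BEFORE the test function, the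
covering weight and the finite set of classes; the constant term of the class `i` is then the DISPLAYED number of Prop. 7.3.2
(a)–(e) at the key `zrep i = ζ ∈ L¹` (representative `z₁ = ι(ratCenter ζ)`), uniform in the class AND in `f`. Companion of ★
`UnitaryGroupSingularSocketClosedSpelled` (the singular socket, one `C` first).

* §1 **`exists_const_rep_sum_filter_central_classPolynomial_eval_zero_linear_cm`**: `∃ C₀ C₁ C₂ (signs), ∀ f hf β hβ S P hP, ∃ zrep`,
  key relation `(((X − zrep i)³) ⊗ 𝔸_L, true) = i` on the central filter and
  **`Σ_{S.filter central} (P i).eval 0 = Σ_{S.filter central} Bc_{C₀,C₁,C₂}(f, zrep i)`** (spelled).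
* §2 **`exists_const_keyrep_sum_filter_central_classPolynomial_eval_zero_linear_cm`** — the same in the shape of the `closerC`
  hypothesis of ★ `arthurTrace_eq_orbital_add_central_add_singular_add_hyperbolic_of_closers` (`UnitaryGroupArthurTraceThreeSocketsClosed`)
  at `κc := ↥(ratOne L⁺ L c)`, `Bc ζ := Bc_{C₀,C₁,C₂}(f, ζ)`: `∃ C₀ C₁ C₂ (signs), ∀ f hf β hβ S P hP, ∃ zrep, Σ (P i).eval 0 = Σ Bc (zrep i)`.

## References

* J. D. Rogawski, *Automorphic Representations of Unitary Groups in Three Variables*, Annals of Mathematics Studies 123 (1990),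
  Prop. 7.3.2 (pp. 96–97), §2.2–2.3 (pp. 13–14), Prop. 3.9.1 (p. 32) [Rogawski1990].
* J. Arthur, *The trace formula in invariant form*, Ann. of Math. 114 (1981), Prop. 2.3 [Arthur1981TraceFormulaInvariantForm].
-/

set_option autoImplicit false

noncomputable section

open MeasureTheory MeasureTheory.Measure NumberField IsDedekindDomain Set Filter Polynomial Function Literature.MeasureTheory.Group
open scoped ENNReal NNReal MatrixGroups Classical
open Literature.NumberTheory.Automorphic.Meyer
open Literature.NumberTheory.QuadraticForms (normIdeles)

namespace Literature.NumberTheory.Automorphic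

namespace UnitaryGroup

section CM

/-- **THE CENTRAL SOCKET, CLOSED ON A FINITE SET OF CLASSES WITH CONSTANTS FIRST (CM pin)** [Rogawski1990, Prop. 7.3.2
(pp. 96–97)]. At the CM pair `(L⁺, L, complexConj)`, for Haar measures `ν` (unipotent radical, fundamental domain `𝓕`), `μ`
(automorphic), `ν_G, μ_B, μ_K, μ_T, μ_X, μ_Y, μ_F, ν_I`, a covering weight `w_T` of `T(F)`, the quadratic data `δ, θ` and an idele class
domain `𝓕_L`: THERE ARE `C₀ > 0`, `C₁ > 0`, `C₂ ∈ (0, ∞)` such that for EVERY test function `f`, covering weight `β` of `B(F)♯`, finite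
set `S` of refined indices and class polynomials `P` with `J^T_i(f) = P_i(log T)` for `T ≫ 0` (`i ∈ S`), there are keys
`zrep i = ζ ∈ L¹` with `(((X − ζ)³) ⊗ 𝔸_L, true) = i` on the central filter and
`Σ_{S.filter central} P_i(0) = Σ_{S.filter central} (μ(X)·f(ι ζ) + c_μ·Cc_{C₀}(ζ, f) + B_{C₁,C₂}(ζ, f))` — the displayed constant term
of ★ `exists_const_truncatedTraceClass_central_eq_linear_cm` at `z₁ := ι(ratCenter ζ)`, `cl := cl♭`. ★ KEYED GLUE
`exists_rep_sum_classPolynomial_eval_zero_eq` ∘ ★ `exists_const_truncatedTraceClass_central_eq_linear_cm` ∘ ★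
`borelRefine_charpoly_eq_central_iff` ∘ ★ `exists_ratOne_of_mem_filter_central`.
[cite: Rogawski1990, Prop. 7.3.2 (pp. 96–97)] [cite: Arthur1981TraceFormulaInvariantForm, Prop. 2.3] -/
theorem exists_const_rep_sum_filter_central_classPolynomial_eval_zero_linear_cm (L : Type) [Field L] [NumberField L] [IsCMField L]
    [MeasurableSpace (adelicUnipotent (↥(maximalRealSubfield L)) L (IsCMField.complexConj L) 3)]
    [BorelSpace (adelicUnipotent (↥(maximalRealSubfield L)) L (IsCMField.complexConj L) 3)]
    [MeasurableSpace (quasiSplit (↥(maximalRealSubfield L)) L (IsCMField.complexConj L) 3).Adelic]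
    [BorelSpace (quasiSplit (↥(maximalRealSubfield L)) L (IsCMField.complexConj L) 3).Adelic]
    [MeasurableSpace (AdeleRing (𝓞 L) L)] [BorelSpace (AdeleRing (𝓞 L) L)]
    [MeasurableSpace (GaloisRepresentations.ideleGroup L)] [BorelSpace (GaloisRepresentations.ideleGroup L)]
    [MeasurableSpace (AdeleRing (𝓞 (↥(maximalRealSubfield L))) (↥(maximalRealSubfield L)))ˣ]
    [BorelSpace (AdeleRing (𝓞 (↥(maximalRealSubfield L))) (↥(maximalRealSubfield L)))ˣ]
    (ν : Measure (adelicUnipotent (↥(maximalRealSubfield L)) L (IsCMField.complexConj L) 3)) [ν.IsHaarMeasure]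
    {𝓕 : Set (adelicUnipotent (↥(maximalRealSubfield L)) L (IsCMField.complexConj L) 3)} (h𝓕 : IsFundamentalDomain (rationalUnipotent (↥(maximalRealSubfield L)) L (IsCMField.complexConj L) 3) 𝓕 ν)
    (μ : Measure (quasiSplit (↥(maximalRealSubfield L)) L (IsCMField.complexConj L) 3).automorphicQuotient) [(quasiSplit (↥(maximalRealSubfield L)) L (IsCMField.complexConj L) 3).IsAutomorphicMeasure μ]
    (νG : Measure (quasiSplit (↥(maximalRealSubfield L)) L (IsCMField.complexConj L) 3).Adelic) [νG.IsHaarMeasure]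
    (μB : Measure (borelAdelic (↥(maximalRealSubfield L)) L (IsCMField.complexConj L) 3)) [μB.IsHaarMeasure]
    (μK : Measure ((standardMaximalCompactGL 3 L).comap
      (adelicVal (↥(maximalRealSubfield L)) L (IsCMField.complexConj L) 3 ((StdForm.antidiagonal 3).over L)) : Subgroup (quasiSplit (↥(maximalRealSubfield L)) L (IsCMField.complexConj L) 3).Adelic))
    [μK.IsHaarMeasure]
    (μT : Measure (torusInBorel (↥(maximalRealSubfield L)) L (IsCMField.complexConj L) 3)) [μT.IsHaarMeasure]
    (μX : Measure (AdeleRing (𝓞 L) L)) [μX.IsAddHaarMeasure]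
    (μY : Measure (traceZeroAdele (↥(maximalRealSubfield L)) L (IsCMField.complexConj L))) [μY.IsAddHaarMeasure]
    {wT : torusInBorel (↥(maximalRealSubfield L)) L (IsCMField.complexConj L) 3 → ℝ≥0∞}
    (hwT : IsCoveringWeight ((((quasiSplit (↥(maximalRealSubfield L)) L (IsCMField.complexConj L) 3).arithmeticSubgroup).subgroupOf (borelAdelic (↥(maximalRealSubfield L)) L (IsCMField.complexConj L) 3)).subgroupOf
      (torusInBorel (↥(maximalRealSubfield L)) L (IsCMField.complexConj L) 3)) wT)
    -- the centre-lattice data ((C) road, Prop. 7.3.2 (c)+(d)): `E = F(δ)`, `δ² = θ`, a Haar measure of `𝕀_F`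
    {δ : L} (hcδ : (IsCMField.complexConj L) δ = -δ) (hδ : δ ≠ 0) (θ : 𝓞 (↥(maximalRealSubfield L))) (hθ : θ ≠ 0)
    (hd : δ * δ = algebraMap (↥(maximalRealSubfield L)) L (θ : (↥(maximalRealSubfield L))))
    (μF : Measure (AdeleRing (𝓞 (↥(maximalRealSubfield L))) (↥(maximalRealSubfield L)))ˣ) [IsHaarMeasure μF]
    -- the (E) road letters
    (νI : Measure (GaloisRepresentations.ideleGroup L)) [νI.IsHaarMeasure]
    {𝓕E : Set (GaloisRepresentations.ideleGroup L)} (h𝓕E : IsIdeleClassDomain L 𝓕E)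
    :
    haveI := t2Space_adeleRing_of_numberField L
    haveI := locallyCompactSpace_adeleRing' L
    haveI := secondCountableTopology_adeleRing L
    haveI : T2Space (quasiSplit (↥(maximalRealSubfield L)) L (IsCMField.complexConj L) 3).Adelic :=
      inferInstanceAs (T2Space (adelic (↥(maximalRealSubfield L)) L (IsCMField.complexConj L) 3 ((StdForm.antidiagonal 3).over L)))
    haveI : LocallyCompactSpace (quasiSplit (↥(maximalRealSubfield L)) L (IsCMField.complexConj L) 3).Adelic :=
      inferInstanceAs (LocallyCompactSpace (adelic (↥(maximalRealSubfield L)) L (IsCMField.complexConj L) 3 ((StdForm.antidiagonal 3).over L)))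
    haveI : SecondCountableTopology (quasiSplit (↥(maximalRealSubfield L)) L (IsCMField.complexConj L) 3).Adelic :=
      inferInstanceAs (SecondCountableTopology (adelic (↥(maximalRealSubfield L)) L (IsCMField.complexConj L) 3 ((StdForm.antidiagonal 3).over L)))
    haveI : DiscreteTopology (quasiSplit (↥(maximalRealSubfield L)) L (IsCMField.complexConj L) 3).quotientSubgroup := by
      rw [quotientSubgroup_quasiSplit]; exact isDiscreteRational_quasiSplit
    letI := AdelicGroupData.measurableSpaceQuotientForm (quasiSplit (↥(maximalRealSubfield L)) L (IsCMField.complexConj L) 3)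
    haveI := AdelicGroupData.borelSpaceQuotientForm (quasiSplit (↥(maximalRealSubfield L)) L (IsCMField.complexConj L) 3)
    haveI := AdelicGroupData.smulInvariantMeasureQuotientForm (quasiSplit (↥(maximalRealSubfield L)) L (IsCMField.complexConj L) 3) μ
    haveI := AdelicGroupData.isFiniteMeasureOnCompactsQuotientForm (quasiSplit (↥(maximalRealSubfield L)) L (IsCMField.complexConj L) 3) μ
    ∃ C₀ : ℝ≥0, 0 < C₀ ∧ ∃ C₁ : ℝ, 0 < C₁ ∧ ∃ C₂ : ℝ≥0∞, C₂ ≠ 0 ∧ C₂ ≠ ∞ ∧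
    ∀ {f : (quasiSplit (↥(maximalRealSubfield L)) L (IsCMField.complexConj L) 3).Adelic → ℂ} (hf : IsQuasiSplitTest (↥(maximalRealSubfield L)) L (IsCMField.complexConj L) 3 f)
      {β : (quasiSplit (↥(maximalRealSubfield L)) L (IsCMField.complexConj L) 3).Adelic → ℝ≥0∞}
      (hβ : IsCoveringWeight ((arithmeticBorel (↥(maximalRealSubfield L)) L (IsCMField.complexConj L) 3).map (quasiSplit (↥(maximalRealSubfield L)) L (IsCMField.complexConj L) 3).arithmeticSubgroup.subtype) β)
      (S : Finset ((AdeleRing (𝓞 L) L)[X] × Bool)) (P : (AdeleRing (𝓞 L) L)[X] × Bool → ℂ[X])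
      (hP : ∀ i ∈ S, ∃ T₀ : ℝ≥0, ∀ T : ℝ≥0, T₀ < T →
        truncatedTraceClass μ ν 𝓕 T
          (fun γ : (quasiSplit (↥(maximalRealSubfield L)) L (IsCMField.complexConj L) 3).arithmeticSubgroup =>
            (((adelicVal (↥(maximalRealSubfield L)) L (IsCMField.complexConj L) 3 _
                (γ : (quasiSplit (↥(maximalRealSubfield L)) L (IsCMField.complexConj L) 3).Adelic) :
                GL (Fin 3) (AdeleRing (𝓞 L) L)) : Matrix (Fin 3) (Fin 3) (AdeleRing (𝓞 L) L)).charpoly,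
              decide (∃ δ : (quasiSplit (↥(maximalRealSubfield L)) L (IsCMField.complexConj L) 3).arithmeticSubgroup,
                δ * γ * δ⁻¹ ∈ arithmeticBorel (↥(maximalRealSubfield L)) L (IsCMField.complexConj L) 3)))
          i f = (P i).eval ((Real.log (T : ℝ) : ℝ) : ℂ)),
      ∃ zrep : (AdeleRing (𝓞 L) L)[X] × Bool → ratOne (↥(maximalRealSubfield L)) L (IsCMField.complexConj L),
        (∀ i ∈ S.filter (fun i : (AdeleRing (𝓞 L) L)[X] × Bool => i.2 = true ∧
          ∃ z : Lˣ, (IsCMField.complexConj L) (z : L) * (z : L) = 1 ∧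
            i.1 = ((X - C (z : L)) ^ 3).map (algebraMap L (AdeleRing (𝓞 L) L))),
          ((((X - C (((zrep i : Lˣ) : L))) ^ 3).map (algebraMap L (AdeleRing (𝓞 L) L))), true) = i) ∧
        ∑ i ∈ S.filter (fun i : (AdeleRing (𝓞 L) L)[X] × Bool => i.2 = true ∧
          ∃ z : Lˣ, (IsCMField.complexConj L) (z : L) * (z : L) = 1 ∧
            i.1 = ((X - C (z : L)) ^ 3).map (algebraMap L (AdeleRing (𝓞 L) L))), (P i).eval 0 =
          ∑ i ∈ S.filter (fun i : (AdeleRing (𝓞 L) L)[X] × Bool => i.2 = true ∧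
          ∃ z : Lˣ, (IsCMField.complexConj L) (z : L) * (z : L) = 1 ∧
            i.1 = ((X - C (z : L)) ^ 3).map (algebraMap L (AdeleRing (𝓞 L) L))),
          ((μ.real Set.univ : ℝ) • f ((quasiSplit (↥(maximalRealSubfield L)) L (IsCMField.complexConj L) 3).toAdelic (ratCenter (↥(maximalRealSubfield L)) L (IsCMField.complexConj L) 3 ((StdForm.antidiagonal 3).over L) (zrep i))) +
            ((unfoldingConstant (quasiSplit (↥(maximalRealSubfield L)) L (IsCMField.complexConj L) 3).quotientSubgroup
            (count : Measure (quasiSplit (↥(maximalRealSubfield L)) L (IsCMField.complexConj L) 3).quotientSubgroup) μ νG : ℝ) : ℂ) * ((((C₀ : ℝ) : ℂ) * ((heisHaar (complexConj_mul_complexConj L) μX μY).real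
              (heisHomeomorph (complexConj_mul_complexConj L) '' (adeleFundamentalDomain L ×ˢ traceZeroFundamentalDomain (↥(maximalRealSubfield L)) L (IsCMField.complexConj L))) : ℂ) *
            ∫ y in ↑(GaloisRepresentations.principalIdeles (↥(maximalRealSubfield L)) ⊔ normIdeles (↥(maximalRealSubfield L)) (θ : (↥(maximalRealSubfield L)))),
              (((IdeleClassGroup.ideleNorm (↥(maximalRealSubfield L)) y ^ 2)⁻¹ : ℝ≥0) : ℝ) •
                ∫ k, f ((k : (quasiSplit (↥(maximalRealSubfield L)) L (IsCMField.complexConj L) 3).Adelic)⁻¹ * (((quasiSplit (↥(maximalRealSubfield L)) L (IsCMField.complexConj L) 3).toAdelic (ratCenter (↥(maximalRealSubfield L)) L (IsCMField.complexConj L) 3 ((StdForm.antidiagonal 3).over L) (zrep i))) *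
                  ((heisChart (complexConj_mul_complexConj L) ((0 : AdeleRing (𝓞 L) L),
                      traceZeroLine (↥(maximalRealSubfield L)) L (IsCMField.complexConj L) hcδ hδ (((y⁻¹ : (AdeleRing (𝓞 (↥(maximalRealSubfield L))) (↥(maximalRealSubfield L)))ˣ)) : AdeleRing (𝓞 (↥(maximalRealSubfield L))) (↥(maximalRealSubfield L)))) :
                    adelicUnipotent (↥(maximalRealSubfield L)) L (IsCMField.complexConj L) 3) : (quasiSplit (↥(maximalRealSubfield L)) L (IsCMField.complexConj L) 3).Adelic)) * (k : (quasiSplit (↥(maximalRealSubfield L)) L (IsCMField.complexConj L) 3).Adelic)) ∂μK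
              ∂μF) +
          ((C₁ : ℂ) * ((μX.real (adeleFundamentalDomain L) : ℂ) * (C₂.toReal : ℂ)) *
            (((∫ x in {x | 1 ≤ (IdeleClassGroup.ideleNorm L x : ℝ)} ∩ 𝓕E,
                  ideleSum L (fun x => ∫ y' : traceZeroAdele (↥(maximalRealSubfield L)) L (IsCMField.complexConj L),
        (∫ k, f ((k : (quasiSplit (↥(maximalRealSubfield L)) L (IsCMField.complexConj L) 3).Adelic)⁻¹ * (((quasiSplit (↥(maximalRealSubfield L)) L (IsCMField.complexConj L) 3).toAdelic (ratCenter (↥(maximalRealSubfield L)) L (IsCMField.complexConj L) 3 ((StdForm.antidiagonal 3).over L) (zrep i))) *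
          (((heisChart (complexConj_mul_complexConj L) (x, y')) : adelicUnipotent (↥(maximalRealSubfield L)) L (IsCMField.complexConj L) 3) :
              (quasiSplit (↥(maximalRealSubfield L)) L (IsCMField.complexConj L) 3).Adelic)) * (k : (quasiSplit (↥(maximalRealSubfield L)) L (IsCMField.complexConj L) 3).Adelic)) ∂μK) ∂μY) x * ((IdeleClassGroup.ideleNorm L x : ℝ) : ℂ) ∂νI) +
                ((μX (adeleFundamentalDomain L)).toReal⁻¹ : ℂ) *
                  (∫ x in {x | 1 ≤ (IdeleClassGroup.ideleNorm L x : ℝ)} ∩ 𝓕E,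
                    ideleSum L (adeleFourier L μX (fun x => ∫ y' : traceZeroAdele (↥(maximalRealSubfield L)) L (IsCMField.complexConj L),
        (∫ k, f ((k : (quasiSplit (↥(maximalRealSubfield L)) L (IsCMField.complexConj L) 3).Adelic)⁻¹ * (((quasiSplit (↥(maximalRealSubfield L)) L (IsCMField.complexConj L) 3).toAdelic (ratCenter (↥(maximalRealSubfield L)) L (IsCMField.complexConj L) 3 ((StdForm.antidiagonal 3).over L) (zrep i))) *
          (((heisChart (complexConj_mul_complexConj L) (x, y')) : adelicUnipotent (↥(maximalRealSubfield L)) L (IsCMField.complexConj L) 3) :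
              (quasiSplit (↥(maximalRealSubfield L)) L (IsCMField.complexConj L) 3).Adelic)) * (k : (quasiSplit (↥(maximalRealSubfield L)) L (IsCMField.complexConj L) 3).Adelic)) ∂μK) ∂μY)) x ∂νI) -
                ((idelicCovolume L νI).toReal : ℂ) * (fun x => ∫ y' : traceZeroAdele (↥(maximalRealSubfield L)) L (IsCMField.complexConj L),
        (∫ k, f ((k : (quasiSplit (↥(maximalRealSubfield L)) L (IsCMField.complexConj L) 3).Adelic)⁻¹ * (((quasiSplit (↥(maximalRealSubfield L)) L (IsCMField.complexConj L) 3).toAdelic (ratCenter (↥(maximalRealSubfield L)) L (IsCMField.complexConj L) 3 ((StdForm.antidiagonal 3).over L) (zrep i))) *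
          (((heisChart (complexConj_mul_complexConj L) (x, y')) : adelicUnipotent (↥(maximalRealSubfield L)) L (IsCMField.complexConj L) 3) :
              (quasiSplit (↥(maximalRealSubfield L)) L (IsCMField.complexConj L) 3).Adelic)) * (k : (quasiSplit (↥(maximalRealSubfield L)) L (IsCMField.complexConj L) 3).Adelic)) ∂μK) ∂μY) 0) -
              (((idelicCovolume L νI).toReal : ℂ) * (((μX (adeleFundamentalDomain L)).toReal⁻¹ : ℂ) *
                  adeleFourier L μX (fun x => ∫ y' : traceZeroAdele (↥(maximalRealSubfield L)) L (IsCMField.complexConj L),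
        (∫ k, f ((k : (quasiSplit (↥(maximalRealSubfield L)) L (IsCMField.complexConj L) 3).Adelic)⁻¹ * (((quasiSplit (↥(maximalRealSubfield L)) L (IsCMField.complexConj L) 3).toAdelic (ratCenter (↥(maximalRealSubfield L)) L (IsCMField.complexConj L) 3 ((StdForm.antidiagonal 3).over L) (zrep i))) *
          (((heisChart (complexConj_mul_complexConj L) (x, y')) : adelicUnipotent (↥(maximalRealSubfield L)) L (IsCMField.complexConj L) 3) :
              (quasiSplit (↥(maximalRealSubfield L)) L (IsCMField.complexConj L) 3).Adelic)) * (k : (quasiSplit (↥(maximalRealSubfield L)) L (IsCMField.complexConj L) 3).Adelic)) ∂μK) ∂μY) 0)) *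
                ((Real.log (borelHeight (1 : (quasiSplit (↥(maximalRealSubfield L)) L (IsCMField.complexConj L) 3).Adelic) : ℝ) : ℝ) : ℂ)))))
    := by
  obtain ⟨C₀, hC₀, C₁, hC₁, C₂, hC₂, hC₂', hU⟩ := exists_const_truncatedTraceClass_central_eq_linear_cm L
    (isConjInvariant_borelRefine isConjInvariant_charpoly_adelicVal)
    (isUnipotentInvariantOnBorel_borelRefine isUnipotentInvariantOnBorel_charpoly_adelicVal)
    ν h𝓕 μ νG μB μK μT μX μY hwT hcδ hδ θ hθ hd μF νI h𝓕E
  refine ⟨C₀, hC₀, C₁, hC₁, C₂, hC₂, hC₂', ?_⟩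
  intro f hf β hβ S P hP
  -- ★ KEYED GLUE at the key type `↥(ratOne L⁺ L c)`: the per-key row closer is the constants-first head at `z₁ := ι(ratCenter ζ)`
  obtain ⟨rep, hrep, -, hsum⟩ := exists_rep_sum_classPolynomial_eval_zero_eq S
    (fun i : (AdeleRing (𝓞 L) L)[X] × Bool => i.2 = true ∧
          ∃ z : Lˣ, (IsCMField.complexConj L) (z : L) * (z : L) = 1 ∧
            i.1 = ((X - C (z : L)) ^ 3).map (algebraMap L (AdeleRing (𝓞 L) L)))
    (fun ζ : ratOne (↥(maximalRealSubfield L)) L (IsCMField.complexConj L) =>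
      ((((X - C (((ζ : Lˣ) : L))) ^ 3).map (algebraMap L (AdeleRing (𝓞 L) L))), true))
    (fun _ => True) (fun i hi hpi => exists_ratOne_of_mem_filter_central S i hi hpi)
    (fun ζ _ => hU ζ
      (z₁ := ⟨(quasiSplit (↥(maximalRealSubfield L)) L (IsCMField.complexConj L) 3).toAdelic
        (ratCenter (↥(maximalRealSubfield L)) L (IsCMField.complexConj L) 3 ((StdForm.antidiagonal 3).over L) ζ), _, rfl⟩) rfl
      (borelRefine_charpoly_eq_central_iff (complexConj_mul_complexConj L) ζ) hf hβ)
    P hP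
  exact ⟨rep, fun i hi => (hrep i hi).2, hsum⟩

/-! ## §2 The `closerC` letter of the (L5-ω) skeleton, constants first: key `ζ ∈ L¹`, value the displayed constant term -/

/-- **THE CENTRAL SOCKET CLOSED WITH CONSTANTS FIRST, IN THE SHAPE OF THE `closerC` HYPOTHESIS** of ★
`arthurTrace_eq_orbital_add_central_add_singular_add_hyperbolic_of_closers` (`UnitaryGroupArthurTraceThreeSocketsClosed`) at the key
type `κc := ↥(ratOne L⁺ L c)` and the DISPLAYED value `Bc ζ := μ(X)·f(ι ζ) + c_μ·Cc_{C₀}(ζ, f) + B_{C₁,C₂}(ζ, f)`: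
`∃ C₀ C₁ C₂ (signs), ∀ f hf β hβ S P hP, ∃ zrep, Σ_{S.filter central} P_i(0) = Σ_{S.filter central} Bc (zrep i)` — §1 with the key
relation dropped. Dock: obtain `C₀, C₁, C₂` FIRST, then `intro f hf`, pick any covering weight `β` of `B(F)♯` (★ `exists_isCoveringWeight`)
and feed `closerC := fun S P hP => (this hf hβ S P hP)`.
[cite: Rogawski1990, Prop. 7.3.2 (pp. 96–97)] [cite: Arthur1981TraceFormulaInvariantForm, Prop. 2.3] -/
theorem exists_const_keyrep_sum_filter_central_classPolynomial_eval_zero_linear_cm (L : Type) [Field L] [NumberField L] [IsCMField L]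
    [MeasurableSpace (adelicUnipotent (↥(maximalRealSubfield L)) L (IsCMField.complexConj L) 3)]
    [BorelSpace (adelicUnipotent (↥(maximalRealSubfield L)) L (IsCMField.complexConj L) 3)]
    [MeasurableSpace (quasiSplit (↥(maximalRealSubfield L)) L (IsCMField.complexConj L) 3).Adelic]
    [BorelSpace (quasiSplit (↥(maximalRealSubfield L)) L (IsCMField.complexConj L) 3).Adelic]
    [MeasurableSpace (AdeleRing (𝓞 L) L)] [BorelSpace (AdeleRing (𝓞 L) L)]
    [MeasurableSpace (GaloisRepresentations.ideleGroup L)] [BorelSpace (GaloisRepresentations.ideleGroup L)]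
    [MeasurableSpace (AdeleRing (𝓞 (↥(maximalRealSubfield L))) (↥(maximalRealSubfield L)))ˣ]
    [BorelSpace (AdeleRing (𝓞 (↥(maximalRealSubfield L))) (↥(maximalRealSubfield L)))ˣ]
    (ν : Measure (adelicUnipotent (↥(maximalRealSubfield L)) L (IsCMField.complexConj L) 3)) [ν.IsHaarMeasure]
    {𝓕 : Set (adelicUnipotent (↥(maximalRealSubfield L)) L (IsCMField.complexConj L) 3)} (h𝓕 : IsFundamentalDomain (rationalUnipotent (↥(maximalRealSubfield L)) L (IsCMField.complexConj L) 3) 𝓕 ν)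
    (μ : Measure (quasiSplit (↥(maximalRealSubfield L)) L (IsCMField.complexConj L) 3).automorphicQuotient) [(quasiSplit (↥(maximalRealSubfield L)) L (IsCMField.complexConj L) 3).IsAutomorphicMeasure μ]
    (νG : Measure (quasiSplit (↥(maximalRealSubfield L)) L (IsCMField.complexConj L) 3).Adelic) [νG.IsHaarMeasure]
    (μB : Measure (borelAdelic (↥(maximalRealSubfield L)) L (IsCMField.complexConj L) 3)) [μB.IsHaarMeasure]
    (μK : Measure ((standardMaximalCompactGL 3 L).comap
      (adelicVal (↥(maximalRealSubfield L)) L (IsCMField.complexConj L) 3 ((StdForm.antidiagonal 3).over L)) : Subgroup (quasiSplit (↥(maximalRealSubfield L)) L (IsCMField.complexConj L) 3).Adelic))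
    [μK.IsHaarMeasure]
    (μT : Measure (torusInBorel (↥(maximalRealSubfield L)) L (IsCMField.complexConj L) 3)) [μT.IsHaarMeasure]
    (μX : Measure (AdeleRing (𝓞 L) L)) [μX.IsAddHaarMeasure]
    (μY : Measure (traceZeroAdele (↥(maximalRealSubfield L)) L (IsCMField.complexConj L))) [μY.IsAddHaarMeasure]
    {wT : torusInBorel (↥(maximalRealSubfield L)) L (IsCMField.complexConj L) 3 → ℝ≥0∞}
    (hwT : IsCoveringWeight ((((quasiSplit (↥(maximalRealSubfield L)) L (IsCMField.complexConj L) 3).arithmeticSubgroup).subgroupOf (borelAdelic (↥(maximalRealSubfield L)) L (IsCMField.complexConj L) 3)).subgroupOf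
      (torusInBorel (↥(maximalRealSubfield L)) L (IsCMField.complexConj L) 3)) wT)
    -- the centre-lattice data ((C) road, Prop. 7.3.2 (c)+(d)): `E = F(δ)`, `δ² = θ`, a Haar measure of `𝕀_F`
    {δ : L} (hcδ : (IsCMField.complexConj L) δ = -δ) (hδ : δ ≠ 0) (θ : 𝓞 (↥(maximalRealSubfield L))) (hθ : θ ≠ 0)
    (hd : δ * δ = algebraMap (↥(maximalRealSubfield L)) L (θ : (↥(maximalRealSubfield L))))
    (μF : Measure (AdeleRing (𝓞 (↥(maximalRealSubfield L))) (↥(maximalRealSubfield L)))ˣ) [IsHaarMeasure μF]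
    -- the (E) road letters
    (νI : Measure (GaloisRepresentations.ideleGroup L)) [νI.IsHaarMeasure]
    {𝓕E : Set (GaloisRepresentations.ideleGroup L)} (h𝓕E : IsIdeleClassDomain L 𝓕E)
    :
    haveI := t2Space_adeleRing_of_numberField L
    haveI := locallyCompactSpace_adeleRing' L
    haveI := secondCountableTopology_adeleRing L
    haveI : T2Space (quasiSplit (↥(maximalRealSubfield L)) L (IsCMField.complexConj L) 3).Adelic :=
      inferInstanceAs (T2Space (adelic (↥(maximalRealSubfield L)) L (IsCMField.complexConj L) 3 ((StdForm.antidiagonal 3).over L)))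
    haveI : LocallyCompactSpace (quasiSplit (↥(maximalRealSubfield L)) L (IsCMField.complexConj L) 3).Adelic :=
      inferInstanceAs (LocallyCompactSpace (adelic (↥(maximalRealSubfield L)) L (IsCMField.complexConj L) 3 ((StdForm.antidiagonal 3).over L)))
    haveI : SecondCountableTopology (quasiSplit (↥(maximalRealSubfield L)) L (IsCMField.complexConj L) 3).Adelic :=
      inferInstanceAs (SecondCountableTopology (adelic (↥(maximalRealSubfield L)) L (IsCMField.complexConj L) 3 ((StdForm.antidiagonal 3).over L)))
    haveI : DiscreteTopology (quasiSplit (↥(maximalRealSubfield L)) L (IsCMField.complexConj L) 3).quotientSubgroup := by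
      rw [quotientSubgroup_quasiSplit]; exact isDiscreteRational_quasiSplit
    letI := AdelicGroupData.measurableSpaceQuotientForm (quasiSplit (↥(maximalRealSubfield L)) L (IsCMField.complexConj L) 3)
    haveI := AdelicGroupData.borelSpaceQuotientForm (quasiSplit (↥(maximalRealSubfield L)) L (IsCMField.complexConj L) 3)
    haveI := AdelicGroupData.smulInvariantMeasureQuotientForm (quasiSplit (↥(maximalRealSubfield L)) L (IsCMField.complexConj L) 3) μ
    haveI := AdelicGroupData.isFiniteMeasureOnCompactsQuotientForm (quasiSplit (↥(maximalRealSubfield L)) L (IsCMField.complexConj L) 3) μ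
    ∃ C₀ : ℝ≥0, 0 < C₀ ∧ ∃ C₁ : ℝ, 0 < C₁ ∧ ∃ C₂ : ℝ≥0∞, C₂ ≠ 0 ∧ C₂ ≠ ∞ ∧
    ∀ {f : (quasiSplit (↥(maximalRealSubfield L)) L (IsCMField.complexConj L) 3).Adelic → ℂ} (hf : IsQuasiSplitTest (↥(maximalRealSubfield L)) L (IsCMField.complexConj L) 3 f)
      {β : (quasiSplit (↥(maximalRealSubfield L)) L (IsCMField.complexConj L) 3).Adelic → ℝ≥0∞}
      (hβ : IsCoveringWeight ((arithmeticBorel (↥(maximalRealSubfield L)) L (IsCMField.complexConj L) 3).map (quasiSplit (↥(maximalRealSubfield L)) L (IsCMField.complexConj L) 3).arithmeticSubgroup.subtype) β)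
      (S : Finset ((AdeleRing (𝓞 L) L)[X] × Bool)) (P : (AdeleRing (𝓞 L) L)[X] × Bool → ℂ[X])
      (hP : ∀ i ∈ S, ∃ T₀ : ℝ≥0, ∀ T : ℝ≥0, T₀ < T →
        truncatedTraceClass μ ν 𝓕 T
          (fun γ : (quasiSplit (↥(maximalRealSubfield L)) L (IsCMField.complexConj L) 3).arithmeticSubgroup =>
            (((adelicVal (↥(maximalRealSubfield L)) L (IsCMField.complexConj L) 3 _
                (γ : (quasiSplit (↥(maximalRealSubfield L)) L (IsCMField.complexConj L) 3).Adelic) :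
                GL (Fin 3) (AdeleRing (𝓞 L) L)) : Matrix (Fin 3) (Fin 3) (AdeleRing (𝓞 L) L)).charpoly,
              decide (∃ δ : (quasiSplit (↥(maximalRealSubfield L)) L (IsCMField.complexConj L) 3).arithmeticSubgroup,
                δ * γ * δ⁻¹ ∈ arithmeticBorel (↥(maximalRealSubfield L)) L (IsCMField.complexConj L) 3)))
          i f = (P i).eval ((Real.log (T : ℝ) : ℝ) : ℂ)),
      ∃ zrep : (AdeleRing (𝓞 L) L)[X] × Bool → ratOne (↥(maximalRealSubfield L)) L (IsCMField.complexConj L),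
        ∑ i ∈ S.filter (fun i : (AdeleRing (𝓞 L) L)[X] × Bool => i.2 = true ∧
          ∃ z : Lˣ, (IsCMField.complexConj L) (z : L) * (z : L) = 1 ∧
            i.1 = ((X - C (z : L)) ^ 3).map (algebraMap L (AdeleRing (𝓞 L) L))), (P i).eval 0 =
          ∑ i ∈ S.filter (fun i : (AdeleRing (𝓞 L) L)[X] × Bool => i.2 = true ∧
          ∃ z : Lˣ, (IsCMField.complexConj L) (z : L) * (z : L) = 1 ∧
            i.1 = ((X - C (z : L)) ^ 3).map (algebraMap L (AdeleRing (𝓞 L) L))),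
          ((μ.real Set.univ : ℝ) • f ((quasiSplit (↥(maximalRealSubfield L)) L (IsCMField.complexConj L) 3).toAdelic (ratCenter (↥(maximalRealSubfield L)) L (IsCMField.complexConj L) 3 ((StdForm.antidiagonal 3).over L) (zrep i))) +
            ((unfoldingConstant (quasiSplit (↥(maximalRealSubfield L)) L (IsCMField.complexConj L) 3).quotientSubgroup
            (count : Measure (quasiSplit (↥(maximalRealSubfield L)) L (IsCMField.complexConj L) 3).quotientSubgroup) μ νG : ℝ) : ℂ) * ((((C₀ : ℝ) : ℂ) * ((heisHaar (complexConj_mul_complexConj L) μX μY).real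
              (heisHomeomorph (complexConj_mul_complexConj L) '' (adeleFundamentalDomain L ×ˢ traceZeroFundamentalDomain (↥(maximalRealSubfield L)) L (IsCMField.complexConj L))) : ℂ) *
            ∫ y in ↑(GaloisRepresentations.principalIdeles (↥(maximalRealSubfield L)) ⊔ normIdeles (↥(maximalRealSubfield L)) (θ : (↥(maximalRealSubfield L)))),
              (((IdeleClassGroup.ideleNorm (↥(maximalRealSubfield L)) y ^ 2)⁻¹ : ℝ≥0) : ℝ) •
                ∫ k, f ((k : (quasiSplit (↥(maximalRealSubfield L)) L (IsCMField.complexConj L) 3).Adelic)⁻¹ * (((quasiSplit (↥(maximalRealSubfield L)) L (IsCMField.complexConj L) 3).toAdelic (ratCenter (↥(maximalRealSubfield L)) L (IsCMField.complexConj L) 3 ((StdForm.antidiagonal 3).over L) (zrep i))) *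
                  ((heisChart (complexConj_mul_complexConj L) ((0 : AdeleRing (𝓞 L) L),
                      traceZeroLine (↥(maximalRealSubfield L)) L (IsCMField.complexConj L) hcδ hδ (((y⁻¹ : (AdeleRing (𝓞 (↥(maximalRealSubfield L))) (↥(maximalRealSubfield L)))ˣ)) : AdeleRing (𝓞 (↥(maximalRealSubfield L))) (↥(maximalRealSubfield L)))) :
                    adelicUnipotent (↥(maximalRealSubfield L)) L (IsCMField.complexConj L) 3) : (quasiSplit (↥(maximalRealSubfield L)) L (IsCMField.complexConj L) 3).Adelic)) * (k : (quasiSplit (↥(maximalRealSubfield L)) L (IsCMField.complexConj L) 3).Adelic)) ∂μK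
              ∂μF) +
          ((C₁ : ℂ) * ((μX.real (adeleFundamentalDomain L) : ℂ) * (C₂.toReal : ℂ)) *
            (((∫ x in {x | 1 ≤ (IdeleClassGroup.ideleNorm L x : ℝ)} ∩ 𝓕E,
                  ideleSum L (fun x => ∫ y' : traceZeroAdele (↥(maximalRealSubfield L)) L (IsCMField.complexConj L),
        (∫ k, f ((k : (quasiSplit (↥(maximalRealSubfield L)) L (IsCMField.complexConj L) 3).Adelic)⁻¹ * (((quasiSplit (↥(maximalRealSubfield L)) L (IsCMField.complexConj L) 3).toAdelic (ratCenter (↥(maximalRealSubfield L)) L (IsCMField.complexConj L) 3 ((StdForm.antidiagonal 3).over L) (zrep i))) *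
          (((heisChart (complexConj_mul_complexConj L) (x, y')) : adelicUnipotent (↥(maximalRealSubfield L)) L (IsCMField.complexConj L) 3) :
              (quasiSplit (↥(maximalRealSubfield L)) L (IsCMField.complexConj L) 3).Adelic)) * (k : (quasiSplit (↥(maximalRealSubfield L)) L (IsCMField.complexConj L) 3).Adelic)) ∂μK) ∂μY) x * ((IdeleClassGroup.ideleNorm L x : ℝ) : ℂ) ∂νI) +
                ((μX (adeleFundamentalDomain L)).toReal⁻¹ : ℂ) *
                  (∫ x in {x | 1 ≤ (IdeleClassGroup.ideleNorm L x : ℝ)} ∩ 𝓕E,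
                    ideleSum L (adeleFourier L μX (fun x => ∫ y' : traceZeroAdele (↥(maximalRealSubfield L)) L (IsCMField.complexConj L),
        (∫ k, f ((k : (quasiSplit (↥(maximalRealSubfield L)) L (IsCMField.complexConj L) 3).Adelic)⁻¹ * (((quasiSplit (↥(maximalRealSubfield L)) L (IsCMField.complexConj L) 3).toAdelic (ratCenter (↥(maximalRealSubfield L)) L (IsCMField.complexConj L) 3 ((StdForm.antidiagonal 3).over L) (zrep i))) *
          (((heisChart (complexConj_mul_complexConj L) (x, y')) : adelicUnipotent (↥(maximalRealSubfield L)) L (IsCMField.complexConj L) 3) :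
              (quasiSplit (↥(maximalRealSubfield L)) L (IsCMField.complexConj L) 3).Adelic)) * (k : (quasiSplit (↥(maximalRealSubfield L)) L (IsCMField.complexConj L) 3).Adelic)) ∂μK) ∂μY)) x ∂νI) -
                ((idelicCovolume L νI).toReal : ℂ) * (fun x => ∫ y' : traceZeroAdele (↥(maximalRealSubfield L)) L (IsCMField.complexConj L),
        (∫ k, f ((k : (quasiSplit (↥(maximalRealSubfield L)) L (IsCMField.complexConj L) 3).Adelic)⁻¹ * (((quasiSplit (↥(maximalRealSubfield L)) L (IsCMField.complexConj L) 3).toAdelic (ratCenter (↥(maximalRealSubfield L)) L (IsCMField.complexConj L) 3 ((StdForm.antidiagonal 3).over L) (zrep i))) *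
          (((heisChart (complexConj_mul_complexConj L) (x, y')) : adelicUnipotent (↥(maximalRealSubfield L)) L (IsCMField.complexConj L) 3) :
              (quasiSplit (↥(maximalRealSubfield L)) L (IsCMField.complexConj L) 3).Adelic)) * (k : (quasiSplit (↥(maximalRealSubfield L)) L (IsCMField.complexConj L) 3).Adelic)) ∂μK) ∂μY) 0) -
              (((idelicCovolume L νI).toReal : ℂ) * (((μX (adeleFundamentalDomain L)).toReal⁻¹ : ℂ) *
                  adeleFourier L μX (fun x => ∫ y' : traceZeroAdele (↥(maximalRealSubfield L)) L (IsCMField.complexConj L),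
        (∫ k, f ((k : (quasiSplit (↥(maximalRealSubfield L)) L (IsCMField.complexConj L) 3).Adelic)⁻¹ * (((quasiSplit (↥(maximalRealSubfield L)) L (IsCMField.complexConj L) 3).toAdelic (ratCenter (↥(maximalRealSubfield L)) L (IsCMField.complexConj L) 3 ((StdForm.antidiagonal 3).over L) (zrep i))) *
          (((heisChart (complexConj_mul_complexConj L) (x, y')) : adelicUnipotent (↥(maximalRealSubfield L)) L (IsCMField.complexConj L) 3) :
              (quasiSplit (↥(maximalRealSubfield L)) L (IsCMField.complexConj L) 3).Adelic)) * (k : (quasiSplit (↥(maximalRealSubfield L)) L (IsCMField.complexConj L) 3).Adelic)) ∂μK) ∂μY) 0)) *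
                ((Real.log (borelHeight (1 : (quasiSplit (↥(maximalRealSubfield L)) L (IsCMField.complexConj L) 3).Adelic) : ℝ) : ℝ) : ℂ)))))
    := by
  obtain ⟨C₀, hC₀, C₁, hC₁, C₂, hC₂, hC₂', h⟩ :=
    exists_const_rep_sum_filter_central_classPolynomial_eval_zero_linear_cm L ν h𝓕 μ νG μB μK μT μX μY hwT hcδ hδ θ hθ hd
      μF νI h𝓕E
  refine ⟨C₀, hC₀, C₁, hC₁, C₂, hC₂, hC₂', ?_⟩
  intro f hf β hβ S P hP
  obtain ⟨zrep, -, hsum⟩ := h hf hβ S P hP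
  exact ⟨zrep, hsum⟩

end CM

end UnitaryGroup

end Literature.NumberTheory.Automorphic
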